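import Summits.AtomisticToContinuum.HydrodynamicLimit.Theses.LambertianContactSwap
import Summits.AtomisticToContinuum.HydrodynamicLimit.Theorems.LambertianContactSwapSwapGapEntropyTransfer
import Literature.MathematicalPhysics.KineticTheory.LambertianHardSphereFlow
import HarnessLib

/-!
# `SwapGap` (stmt-AtomisticToContinuum-11850), line `Sketch`, glue stub G2: `FieldRelEntSwap → FieldConcentration → SwapGap`

Helper file (`--supports stmt-AtomisticToContinuum-11850`) of line `Sketch` (card `entropy-relative-to-lambertian-law`) for the crux
`Summit.AtomisticToContinuum.HydrodynamicLimit.Theses.LambertianContactSwap.SwapGap`, registered stub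
`stub_swapGap_of_fieldRelEntSwap_of_fieldConcentration` of the lead's skeleton v6: the line's entropy transfer run on the
field space `ℝ × V3 × ℝ` instead of the `N`-body phase space (cf. the `N`-body version
`swapGap_of_relEntSwap_of_fieldConcentration`, p106427): `o(N)` relative entropy of the field-triple laws (S1″) plus speed-`N`
self-averaging of the Lambertian field statistics (S2) give the merging of the means (the crux).

prover-line-stmt-AtomisticToContinuum-11850-c3-0 (wave 4 worker), cycle 4.
-/

noncomputable section

open MeasureTheory Filter Set Topology InformationTheory
open scoped ENNReal

namespace Summit.AtomisticToContinuum.HydrodynamicLimit.Theorems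

open Literature.Analysis.FluidPDE Literature.MathematicalPhysics.KineticTheory
open Summit.AtomisticToContinuum.HydrodynamicLimit.Theses.LambertianContactSwap

/-- **`SwapGap` from `FieldRelEntSwap` (S1″) and `FieldConcentration` (S2)**: with `σ₀ := min (1/2) (min σ₁ σ₂)`, for
`σ < σ₀`, Euler data, flows, the `t = 0` hypothesis, `t < T`, `χ`, `F`: put `μ_N`, `ν_N` := the laws on `ℝ × V3 × ℝ` of the
`χ`-tested field triple at time `t` under the deterministic and the Lambertian gas (finite measures; `Λ_t` jointly measurable for
`σ < 1/2`, `measurable_lambertFlow_hsDiameter`; the triple measurable, `measurable_fieldTriple`), `m_N := ∫ F(fld(Λ_t)) d(P_N ⊗ γ^ℕ)`.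
S2 gives `ν_N{δ < |F − m_N|} ≤ C e^{−(N+1)/C}` (`Measure.map_apply`), S1″ gives `KL(μ_N ‖ ν_N)/(N+1) → 0`, the entropy inequality
for events (`tendsto_measure_of_klDiv_div_tendsto_zero`) gives `μ_N{δ < |F − m_N|} = P_N{δ < |F(fld(Φ_t z)) − m_N|} → 0` for every
`δ > 0`, and `tendsto_integral_sub_of_tendsto_measure` gives `∫ F(fld(Φ_t z)) dP_N − m_N → 0`, the crux (`m_N` is literally its
Lambertian term: the route's inline `let` block is the Literature API definitionally). [cite: KipnisLandim1999, Ch. 6 §1] -/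
theorem stub_swapGap_of_fieldRelEntSwap_of_fieldConcentration
    (h1 :
    ∀ (a₀ θ₀ : T3 → ℝ) (u₀ : T3 → V3), Continuous a₀ → Continuous θ₀ → Continuous u₀ →
      (∀ x, 0 < a₀ x) → (∀ x, 0 < θ₀ x) →
      ∃ σ₀ : ℝ, 0 < σ₀ ∧ ∀ σ : ℝ, 0 < σ → σ < σ₀ →
        ∀ (T : ℝ) (ρ θ : ℝ → T3 → ℝ) (u : ℝ → T3 → V3), IsHardSphereEulerSolution σ T ρ u θ →
          ∀ Φ : (N : ℕ) → HardSphereFlow (Torus.geometry (Fin 3)) (hsDiameter σ N) (N + 1),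
            TendstoHydroFieldsAt (fun N => localGibbsLaw σ a₀ u₀ θ₀ N (Φ N)) Φ ρ u θ 0 →
              ∀ t ∈ Set.Ico 0 T, ∀ χ : T3 → ℝ, Continuous χ →
                Tendsto (fun N : ℕ =>
                  klDiv
                    ((localGibbsLaw σ a₀ u₀ θ₀ N (Φ N)).map (fun z =>
                      (empiricalDensityField ((Φ N).flow t z) χ,
                        empiricalMomentumField ((Φ N).flow t z) χ,
                        empiricalEnergyField ((Φ N).flow t z) χ)))
                    (((localGibbsLaw σ a₀ u₀ θ₀ N (Φ N)).prod (lambertNoise (Fin 3))).map (fun p =>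
                      (empiricalDensityField
                          (lambertFlow (Torus.geometry (Fin 3)) (hsDiameter σ N) p.2 p.1 t) χ,
                        empiricalMomentumField
                          (lambertFlow (Torus.geometry (Fin 3)) (hsDiameter σ N) p.2 p.1 t) χ,
                        empiricalEnergyField
                          (lambertFlow (Torus.geometry (Fin 3)) (hsDiameter σ N) p.2 p.1 t) χ))) /
                  ((N : ℝ≥0∞) + 1)) atTop (𝓝 0)) 
    (h2 :
    ∀ (a₀ θ₀ : T3 → ℝ) (u₀ : T3 → V3), Continuous a₀ → Continuous θ₀ → Continuous u₀ →
      (∀ x, 0 < a₀ x) → (∀ x, 0 < θ₀ x) →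
      ∃ σ₀ : ℝ, 0 < σ₀ ∧ ∀ σ : ℝ, 0 < σ → σ < σ₀ →
        ∀ (T : ℝ) (ρ θ : ℝ → T3 → ℝ) (u : ℝ → T3 → V3), IsHardSphereEulerSolution σ T ρ u θ →
          ∀ Φ : (N : ℕ) → HardSphereFlow (Torus.geometry (Fin 3)) (hsDiameter σ N) (N + 1),
            TendstoHydroFieldsAt (fun N => localGibbsLaw σ a₀ u₀ θ₀ N (Φ N)) Φ ρ u θ 0 →
              ∀ t ∈ Set.Ico 0 T, ∀ χ : T3 → ℝ, Continuous χ →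
                ∀ F : ℝ × V3 × ℝ → ℝ, LipschitzWith 1 F → (∀ y, |F y| ≤ 1) → ∀ δ : ℝ, 0 < δ →
                  ∃ C : ℝ, 0 < C ∧ ∀ N : ℕ,
                    ((localGibbsLaw σ a₀ u₀ θ₀ N (Φ N)).prod (lambertNoise (Fin 3)))
                      {p | δ < |F (empiricalDensityField
                              (lambertFlow (Torus.geometry (Fin 3)) (hsDiameter σ N) p.2 p.1 t) χ,
                            empiricalMomentumField
                              (lambertFlow (Torus.geometry (Fin 3)) (hsDiameter σ N) p.2 p.1 t) χ,
                            empiricalEnergyField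
                              (lambertFlow (Torus.geometry (Fin 3)) (hsDiameter σ N) p.2 p.1 t) χ) -
                          ∫ q, F (empiricalDensityField
                              (lambertFlow (Torus.geometry (Fin 3)) (hsDiameter σ N) q.2 q.1 t) χ,
                            empiricalMomentumField
                              (lambertFlow (Torus.geometry (Fin 3)) (hsDiameter σ N) q.2 q.1 t) χ,
                            empiricalEnergyField
                              (lambertFlow (Torus.geometry (Fin 3)) (hsDiameter σ N) q.2 q.1 t) χ)
                            ∂((localGibbsLaw σ a₀ u₀ θ₀ N (Φ N)).prod (lambertNoise (Fin 3)))|} ≤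
                      ENNReal.ofReal (C * Real.exp (-(C⁻¹ * ((N : ℝ) + 1))))) :
    SwapGap := by
  delta Summit.AtomisticToContinuum.HydrodynamicLimit.Theses.LambertianContactSwap.SwapGap
  intro Cfg G ε τ S ldir lpair lstep lstate linst lflow noise fld a₀ θ₀ u₀ ha hθ hu ha0 hθ0
  obtain ⟨σ₁, hσ₁, h1'⟩ := h1 a₀ θ₀ u₀ ha hθ hu ha0 hθ0
  obtain ⟨σ₂, hσ₂, h2'⟩ := h2 a₀ θ₀ u₀ ha hθ hu ha0 hθ0
  refine ⟨min 2⁻¹ (min σ₁ σ₂), lt_min (by norm_num) (lt_min hσ₁ hσ₂), ?_⟩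
  intro σ hσ hσlt T ρ θ u hE Φ P h0 t ht χ hχ F hF hF1
  have hσhalf : σ < 2⁻¹ := hσlt.trans_le (min_le_left _ _)
  have hσ₁' : σ < σ₁ := hσlt.trans_le ((min_le_right _ _).trans (min_le_left _ _))
  have hσ₂' : σ < σ₂ := hσlt.trans_le ((min_le_right _ _).trans (min_le_right _ _))
  -- the laws
  have hPN : ∀ N, IsProbabilityMeasure (P N) := fun N =>
    isProbabilityMeasure_localGibbsLaw ha hθ hu ha0 hθ0 (by linarith) N (Φ N)
  have hnoise : IsProbabilityMeasure noise := by
    show IsProbabilityMeasure (lambertNoise (Fin 3))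
    infer_instance
  -- measurability of the Lambertian flow (the `let` block is the Literature API definitionally)
  have hΛ : ∀ N, Measurable fun p : Cfg N × (ℕ → EuclideanSpace ℝ (Fin 3)) => lflow σ N p.2 p.1 t :=
    fun N => measurable_lambertFlow_hsDiameter hσ.le hσhalf N t
  -- the measurable field triple `fld` and the continuous statistic `F`
  have hfld : ∀ N, Measurable fun y : Cfg N => fld N y χ := fun N => measurable_fieldTriple hχ
  have hFm : Measurable F := hF.continuous.measurable
  have hΛfld : ∀ N, Measurable fun p : Cfg N × (ℕ → EuclideanSpace ℝ (Fin 3)) =>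
      fld N (lflow σ N p.2 p.1 t) χ := fun N => (hfld N).comp (hΛ N)
  have hΦfld : ∀ N, Measurable fun z : Cfg N => fld N ((Φ N).flow t z) χ :=
    fun N => (hfld N).comp ((Φ N).measurable_flow t)
  -- the two image laws on the field space `ℝ × V3 × ℝ`
  set μ : ℕ → Measure (ℝ × EuclideanSpace ℝ (Fin 3) × ℝ) := fun N =>
    (P N).map (fun z => fld N ((Φ N).flow t z) χ) with hμ
  set ν : ℕ → Measure (ℝ × EuclideanSpace ℝ (Fin 3) × ℝ) := fun N =>
    ((P N).prod noise).map (fun p => fld N (lflow σ N p.2 p.1 t) χ) with hν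
  haveI hμfin : ∀ N, IsFiniteMeasure (μ N) := fun N => by
    haveI := hPN N
    exact Measure.isFiniteMeasure_map _ _
  haveI hνfin : ∀ N, IsFiniteMeasure (ν N) := fun N => by
    haveI := hPN N
    exact Measure.isFiniteMeasure_map _ _
  -- the Lambertian means
  set m : ℕ → ℝ := fun N => ∫ p, F (fld N (lflow σ N p.2 p.1 t) χ) ∂((P N).prod noise) with hm
  have hm1 : ∀ N, |m N| ≤ 1 := fun N => by
    haveI := hPN N
    have h := norm_integral_le_of_norm_le_const (μ := (P N).prod noise)
      (f := fun p : Cfg N × (ℕ → EuclideanSpace ℝ (Fin 3)) => F (fld N (lflow σ N p.2 p.1 t) χ))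
      (C := 1) (ae_of_all _ fun p => by
        rw [Real.norm_eq_abs]
        exact hF1 _)
    simpa [hm, Real.norm_eq_abs] using h
  -- S1″: `KL(μ_N ‖ ν_N)/(N+1) → 0`
  have hkl : Tendsto (fun N : ℕ => klDiv (μ N) (ν N) / ((N : ℝ≥0∞) + 1)) atTop (𝓝 0) :=
    h1' σ hσ hσ₁' T ρ θ u hE Φ h0 t ht χ hχ
  -- convergence in `P_N`-probability of `F(fld(Φ_t z))` towards the Lambertian mean
  have hprob : ∀ δ : ℝ, 0 < δ →
      Tendsto (fun N => P N {z | δ < |F (fld N ((Φ N).flow t z) χ) - m N|}) atTop (𝓝 0) := by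
    intro δ hδ
    obtain ⟨C, hC, hconc⟩ := h2' σ hσ hσ₂' T ρ θ u hE Φ h0 t ht χ hχ F hF hF1 δ hδ
    set A : ℕ → Set (ℝ × EuclideanSpace ℝ (Fin 3) × ℝ) := fun N => {y | δ < |F y - m N|} with hA
    have hAm : ∀ N, MeasurableSet (A N) := fun N =>
      measurableSet_lt measurable_const (hFm.sub measurable_const).abs
    have hνA : ∀ N, ν N (A N) ≤ ENNReal.ofReal (C * Real.exp (-(C⁻¹ * ((N : ℝ) + 1)))) := by
      intro N
      rw [hν, Measure.map_apply (hΛfld N) (hAm N)]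
      exact hconc N
    have hμA := tendsto_measure_of_klDiv_div_tendsto_zero
      (Ω := fun _ : ℕ => ℝ × EuclideanSpace ℝ (Fin 3) × ℝ) μ ν A hC hνA hkl
    refine hμA.congr fun N => ?_
    rw [hμ, Measure.map_apply (hΦfld N) (hAm N)]
    rfl
  -- merging of the means
  have hmerge := tendsto_integral_sub_of_tendsto_measure P hPN
    (fun N z => F (fld N ((Φ N).flow t z) χ)) (fun N => hFm.comp (hΦfld N))
    (fun N z => hF1 _) m hm1 hprob
  exact hmerge

end Summit.AtomisticToContinuum.HydrodynamicLimit.Theorems
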